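import Literature.MathematicalPhysics.QuantumFieldTheory.Balaban1983to89.B8BlockConstantLiftCoverRec

/-!
# `Balaban1983to89.B8Prop6DentedCubeMemberGammaPrecompRec` — [Balaban1985RegularSpaces] p. 99 «the assumptions of Theorem 4 are satisfied for the pair of configurations 1, U₀″» ON THE
# DENTED RECORD TOWER, FOR THE PRE-COMPOSED INPUT `(U₀″)^{h}` (`h` unitary, constant on the block towers under the dented cells): the six-conjunct §1 package of
# `B8Prop6DentedCubeMemberGammaRec.thm4_hypotheses_one_cutFixed_dented_γ` with `U₀″ ↦ (U₀″)^{h}` and the (1.66)-type bounds degraded by the oscillation `τ` of `h` — item (B′-4)·2 of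
# the plan's road (B′) for director-ym №310–№312a branch (ii) (pen dag-n05-e g41)

statement-level skeleton of published theorems with citation tags; proofs where landed; nothing here is a claim about the Yang–Mills mass gap

CITATION HEADER (lean-in-tree rule).  Cell `pub-ymgap` (HUMAN RULING D-0062), «N05-REC» road; (B′-4)·1 ✓p744955 `B8BlockConstantLiftCoverRec` (dented-top cover, `InAxZ` at every truncation
for `W^h`), (B′-2) ✓p743942 `B8BlockConstantLiftStabilityRec` (`InAk` invariance, `‖aWb⁻¹ − 1‖ ≤ ‖W − 1‖ + ‖a − b‖`).  THIS FILE is the dented §1 package for the pre-composed input — the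
hypothesis bundle the γ driver `B8Thm4ExistsAtGammaRec.thm4Exists_concrete_at_γ` consumes; the G4 → G8 crown re-assembly on top of it is the successor's generator work.  [6] =
[Balaban1985RegularSpaces] p. 99 (sentence after (1.133)), (1.33)–(1.35) p. 82, (1.66) p. 87; [15] = [Balaban1985Variational] (151) p. 301; [3] = [Balaban1985Averaging] (8), (11) pp. 18–19;
[I] = [Balaban1987RG1] (0.3)–(0.4), (0.6) pp. 252–253.  `--kind proof --supports stmt-QuantumFields-20541` (K0⁷; count-neutral; no definition).
REUSED BY NAME: `B8Prop6DentedCubeMemberGammaRec.thm4_hypotheses_one_cutFixed_dented_γ` (the six conjuncts for `U₀″`), `B8BlockConstantLiftCoverRec.inAxZ_lamST_gaugeAct_of_blockConstant`,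
`B8BlockConstantLiftStabilityRec.{inAk_gaugeAct_of_U1, norm_mul_mul_inv_sub_one_le}`, `BlockAveragingZdCovariance.avgIterZ_gaugeAct_units`, `BlockAveragingZd.avgIterZ_one`,
`B8Eq115GaugeFixing.gaugeAct_mem_of`, `B7Prop2Explicit.unitaryUnits_le_U1`, `B8Lemma1NonAbelian.mulCfg`.

WHAT IS PROVED (sorry-free).  ★★★ `thm4_hypotheses_one_precomposed_dented_γ` — for `h` unitary-valued, constant `= X(j, y)` on the block tower under every dented cell `y ∈ c.lamS j`
(`1 ≤ j ≤ k`), with `‖h_j(z) − h_j(z + e_μ)‖ ≤ τ` on the level-`j` bonds whose centred box lies in `Ω′_{j−1}` (`h_j(w) = h(Lʲ·w)`) and `‖h(x) − h(x + e_μ)‖ ≤ τ` on the level-0 bonds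
touching `Ω′₀`: the six conjuncts for `(U₀″)^{h}` — unitary-valued; (1.33) for `1` on `{Ω′_j}`; (1.34)∕(151) `(U₀″)^h ∈ 𝔄_k({Ω′_j}, L³α₀)`; `Ax` at EVERY truncation w.r.t. the dented
cells; (1.35)∕(1.66) with `6dL²Mα₀ + τ`; the level-0 collar with `6dL²Mα₀ + τ`.
HONEST SCOPE.  Assembly of landed covariance lemmas with the record's §1 package; NO new estimate; the §2 Prop-6 conclusion for the pre-composed input and the G4 → G8 crown twins are
NOT here; branch (ii) licence line as ruled; `HThm4Rec*` CONDITIONAL; N05 DISCHARGED OF RECORD since R467 (count-neutral record-level work), N07 NOT discharged; counts unmoved (typed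
28∕28 · discharged 8∕28); one finite 𝕋⁴ programme at fixed ε, `G = SU(2)` of record — nothing continuum ∕ ℝ⁴ ∕ OS ∕ mass gap ∕ Clay.  No `def`, no `instance`, no `notation`, no `sorry`.
-/

set_option autoImplicit false

noncomputable section

namespace Literature.MathematicalPhysics.QuantumFieldTheory.Balaban1983to89.B8Prop6DentedCubeMemberGammaPrecompRec

open B7Prop1Explicit B7Prop2Explicit B7Prop1Local
open B7Prop2Explicit (c2' unitaryUnits unitaryUnits_le_U1)
open B7Prop2Rec (C0Z)
open B7AvgGaugeCovariance (uLev uLev_apply)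
open BlockAveragingZd (avgIterZ ctrShift avgIterZ_one)
open BlockAveragingZdCovariance (avgIterZ_gaugeAct_units)
open B8Ineq132 (InAk)
open B8Ineq133Rec (cutFixedZ)
open B8Eq115GaugeFixing (gaugeAct_mem_of)
open B8Eq119TwistedAxialRec (InAxZ UnderZ)
open B8Lemma1NonAbelian (mulCfg)
open B8Eq140Level (SideTouches)
open B8Eq131Cubes (tLo tHi ctr)
open B8Prop6DentedCubeMemberGammaRec (thm4_hypotheses_one_cutFixed_dented_γ)
open B8BlockConstantLiftCoverRec (inAxZ_lamST_gaugeAct_of_blockConstant)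
open B8BlockConstantLiftStabilityRec (inAk_gaugeAct_of_U1 norm_mul_mul_inv_sub_one_le)
open Node00 (CubeB8DZ)

export B7Prop1Explicit (Site)

variable {d : ℕ}
variable {L s K : ℕ} {Ω : ℕ → Set (Site d)}
variable {𝔸 : Type*} [CStarAlgebra 𝔸] [Nontrivial 𝔸]

omit [Nontrivial 𝔸] in
/-- `mulCfg W 1 = W`. [folklore] -/
private theorem mulCfg_one_right (W : Site d → Fin d → 𝔸ˣ) : mulCfg W (1 : Site d → Fin d → 𝔸ˣ) = W := by
  funext x μ; simp [mulCfg]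

/-- ★★★ **THE p. 99 ∕ (151) SENTENCE AT THE DENTED RECORD MEMBER FOR THE PRE-COMPOSED INPUT `(U₀″)^{h}`** (γ currency): with `h` unitary-valued and CONSTANT on the block tower under
every dented cell of level `≥ 1`, oscillating by `≤ τ` across the level-`j` bonds of the (1.35) boxes and across the level-0 bonds touching `Ω′₀` — `(U₀″)^h` unitary-valued; (1.33) for
`1` on `{Ω′_j}`; (1.34)∕(151) `(U₀″)^h ∈ 𝔄_k({Ω′_j}, L³α₀)` (gauge invariance); `Ax` at every truncation w.r.t. the dented record cells ((B′-4)·1); (1.35)∕(1.66) for every level-`j` bond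
whose centred box lies in `Ω′_{j−1}`, with `6dL²Mα₀ + τ` (`\overline{(U₀″)^h}ʲ = h_j·\overline{U₀″}ʲ·h_j⁻¹`, [I] (0.6)); (1.66) on the sides touching `Ω′₀` with `6dL²Mα₀ + τ`.
[cite: Balaban1985RegularSpaces, p.99 (sentence after (1.133)), (1.33)–(1.35) p.82, (1.66) p.87; Balaban1985Variational, (151) p.301; Balaban1985Averaging, (8) p.18, (11) p.19; Balaban1987RG1, (0.6) p.253] -/
theorem thm4_hypotheses_one_precomposed_dented_γ (hLs : L = 2 * s + 1) (hs : 1 ≤ s) (hd : 1 ≤ d) (c : CubeB8DZ d L K Ω)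
    (U : Site d → Fin d → 𝔸ˣ) (hU : ∀ x κ, U x κ ∈ unitaryUnits 𝔸) {α₀ : ℝ} (hα : 0 < α₀)
    (hα3 : C0Z d * (α₀ * (L : ℝ) ^ 2) ≤ 1 / 3) (hα2 : 2 * (α₀ * (L : ℝ) ^ 2) ≤ c2' d L)
    {η : ℝ} (hη : 0 < η) (hA : InAk L c.k η α₀ Ω U)
    (hsmall : 11 * (d : ℝ) ^ 2 * (L : ℝ) ^ 2 * α₀ + ((c.M : ℝ) + 4 * c.ρ) * d * (L : ℝ) ^ 2 * α₀ ≤ 1 / 6)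
    -- the pre-composition
    (h : Site d → 𝔸ˣ) (hh : ∀ x, h x ∈ unitaryUnits 𝔸) (X : ℕ → Site d → 𝔸ˣ)
    (hconst : ∀ j, 1 ≤ j → j ≤ c.k → ∀ y ∈ c.lamS j, ∀ x, UnderZ L j y x → h x = X j y)
    {τ : ℝ}
    (hoscj : ∀ j, j ≤ c.k → ∀ (z : Site d) (μ : Fin d),
      (∀ x, InBox (fun i => (L : ℤ) ^ j * z i - (ctrShift L j : ℤ)) (fun i => (L : ℤ) ^ j * z i + (ctrShift L j : ℤ) + if i = μ then (L : ℤ) ^ j else 0) x →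
        x ∈ c.sq (j - 1)) → ‖((uLev L h j z : 𝔸ˣ) : 𝔸) - ((uLev L h j (z + e μ) : 𝔸ˣ) : 𝔸)‖ ≤ τ)
    (hosc0 : ∀ b ∈ {b : Site d × Fin d | SideTouches (c.sq 0) b.1 b.2}, ‖((h b.1 : 𝔸ˣ) : 𝔸) - ((h (b.1 + e b.2) : 𝔸ˣ) : 𝔸)‖ ≤ τ) :
    (∀ x κ, gaugeAct h (cutFixedZ L (tLo c.a c.ρ) (tHi c.a c.M c.ρ) U c.k (ctr c.a c.M)) x κ ∈ unitaryUnits 𝔸) ∧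
    InAk L c.k η ((L : ℝ) ^ 3 * α₀) c.sq (1 : Site d → Fin d → 𝔸ˣ) ∧
    InAk L c.k η ((L : ℝ) ^ 3 * α₀) c.sq (mulCfg (gaugeAct h (cutFixedZ L (tLo c.a c.ρ) (tHi c.a c.M c.ρ) U c.k (ctr c.a c.M))) (1 : Site d → Fin d → 𝔸ˣ)) ∧
    (∀ m, m ≤ c.k → InAxZ L m (c.lamST m) (1 : Site d → Fin d → 𝔸ˣ)
      (mulCfg (gaugeAct h (cutFixedZ L (tLo c.a c.ρ) (tHi c.a c.M c.ρ) U c.k (ctr c.a c.M))) (1 : Site d → Fin d → 𝔸ˣ))) ∧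
    (∀ j, j ≤ c.k → ∀ (z : Site d) (μ : Fin d),
      (∀ x, InBox (fun i => (L : ℤ) ^ j * z i - (ctrShift L j : ℤ)) (fun i => (L : ℤ) ^ j * z i + (ctrShift L j : ℤ) + if i = μ then (L : ℤ) ^ j else 0) x →
        x ∈ c.sq (j - 1)) →
        ‖(avgIterZ L (mulCfg (gaugeAct h (cutFixedZ L (tLo c.a c.ρ) (tHi c.a c.M c.ρ) U c.k (ctr c.a c.M))) (1 : Site d → Fin d → 𝔸ˣ)) j z μ : 𝔸) -
            (avgIterZ L (1 : Site d → Fin d → 𝔸ˣ) j z μ : 𝔸)‖ ≤ 6 * d * (L : ℝ) ^ 2 * c.M * α₀ + τ) ∧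
    (∀ b ∈ {b : Site d × Fin d | SideTouches (c.sq 0) b.1 b.2},
      ‖((gaugeAct h (cutFixedZ L (tLo c.a c.ρ) (tHi c.a c.M c.ρ) U c.k (ctr c.a c.M)) b.1 b.2 : 𝔸ˣ) : 𝔸) - 1‖ ≤ 6 * d * (L : ℝ) ^ 2 * c.M * α₀ + τ) := by
  have hLo : Odd L := ⟨s, hLs⟩
  obtain ⟨hmem, h33, h34, hax, h135, h66⟩ := thm4_hypotheses_one_cutFixed_dented_γ hLs hs hd c U hU hα hα3 hα2 hη hA hsmall
  set W := cutFixedZ L (tLo c.a c.ρ) (tHi c.a c.M c.ρ) U c.k (ctr c.a c.M) with hW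
  have hW1 : mulCfg W (1 : Site d → Fin d → 𝔸ˣ) = W := mulCfg_one_right W
  have hWh1 : mulCfg (gaugeAct h W) (1 : Site d → Fin d → 𝔸ˣ) = gaugeAct h W := mulCfg_one_right _
  have hhU : ∀ x, h x ∈ U1 𝔸 := fun x => unitaryUnits_le_U1 (hh x)
  rw [hW1] at h34 hax h135
  refine ⟨gaugeAct_mem_of hmem hh, h33, ?_, ?_, ?_, ?_⟩
  · rw [hWh1]; exact inAk_gaugeAct_of_U1 L c.k η _ _ hhU h34
  · rw [hWh1]; exact inAxZ_lamST_gaugeAct_of_blockConstant hLo c h X hconst hax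
  · intro j hj z μ hbox
    rw [hWh1, avgIterZ_gaugeAct_units L h W j, avgIterZ_one]
    have hb := norm_mul_mul_inv_sub_one_le (a := uLev L h j z) (b := uLev L h j (z + e μ))
      (hhU (((L : ℤ) ^ j) • z)) (hhU (((L : ℤ) ^ j) • (z + e μ))) ((avgIterZ L W j z μ : 𝔸ˣ) : 𝔸)
    have h1 := h135 j hj z μ hbox
    rw [avgIterZ_one] at h1
    have h2 := hoscj j hj z μ hbox
    show ‖((uLev L h j z * avgIterZ L W j z μ * (uLev L h j (z + e μ))⁻¹ : 𝔸ˣ) : 𝔸) - ((1 : Site d → Fin d → 𝔸ˣ) z μ : 𝔸ˣ)‖ ≤ _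
    rw [Units.val_mul, Units.val_mul, Pi.one_apply, Pi.one_apply, Units.val_one]
    simp only [Pi.one_apply, Units.val_one] at h1
    linarith
  · intro b hb
    have hb' := norm_mul_mul_inv_sub_one_le (a := h b.1) (b := h (b.1 + e b.2)) (hhU _) (hhU _) ((W b.1 b.2 : 𝔸ˣ) : 𝔸)
    have h1 := h66 b hb
    have h2 := hosc0 b hb
    show ‖((h b.1 * W b.1 b.2 * (h (b.1 + e b.2))⁻¹ : 𝔸ˣ) : 𝔸) - 1‖ ≤ _
    rw [Units.val_mul, Units.val_mul]
    linarith

end Literature.MathematicalPhysics.QuantumFieldTheory.Balaban1983to89.B8Prop6DentedCubeMemberGammaPrecompRec
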